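import Summits.KontsevichZagierPeriods.KontsevichZagierPeriods.Theorems.HyperbolicBlochFiveTermTransfer

/-!
# `OffTetraSectorKernel` (stmt-KontsevichZagierPeriods-10557) — line `odd-hyperbolic-ladder`
(skeleton v3), stub `stub_tetraHalving`

Every standard ideal tetrahedron class is TWICE a tetrahedral combination modulo the moves of the
Kontsevich–Zagier calculus: for a standard family `ρ` (`ρ z = [T(z), t⁻³]` on the algebraic upper
half plane) and algebraic `z` with `Im z > 0`,
`[ρ z] − 2 [ρ w] + 2 [ρ (−w̄)] ∈ KZ.relations` for the square root `w` of `z` in the upper half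
plane. This is the duplication formula `D(w²) = 2 D(w) + 2 D(−w)` of the Bloch–Wigner dilogarithm
(Dupont–Sah 1982, Lemma 5.6; Zagier 2007, Ch. I §2), derived INSIDE the calculus for the signed
class map `B = signedClass ρ` from three landed relation families of the sibling crux
`FiveTermTransfer`:

* the five-term relation (`FiveTerm.FiveTermTransfer_of`) at `(x, y) = (w, w²)`:
  `2 B w − B (w²) − B (w/(1+w)) + B (1/(1+w))`;
* the inversion relation `B u + B u⁻¹` (`FiveTerm.stub_inversionRelation`) at `u = 1 + w`;
* the reflection relation `B u + B (1 − u)` (`reflection_mem_relations` below, from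
  `FiveTerm.stub_prismClass` twice: both `B u` and `−B (1 − u)` are `sg u • [prism over (0, 1, u)]`,
  the two prisms `P 1 0 u`, `P 0 1 u` being the same set) at `u = 1/(1+w)` and `u = 1 + w`.

The `ℤ`-combination `five-term + refl(1/(1+w)) − 2·inv(1+w) + 2·refl(1+w)` is
`2 B w − B (w²) + 2 B (−w)`, and `B (−w) = −[ρ (−w̄)]` since `Im (−w) < 0`.
-/

noncomputable section

open MeasureTheory Set Complex
open scoped ComplexConjugate

namespace Summit.KontsevichZagierPeriods.HyperbolicBloch.OffTetraSectorKernel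

open Literature.NumberTheory.Transcendental
open Literature.NumberTheory.Transcendental.KZ
open Summit.KontsevichZagierPeriods.HyperbolicBloch.FiveTermTransferNegative
open Summit.KontsevichZagierPeriods.HyperbolicBloch.FiveTerm

/-- The prism `P u v w` over the triangle `(u, v, w)` (the ideal tetrahedron `(∞, u, v, w)` of the
upper half space, cut out by orientation-corrected edge and circumsphere forms) does not depend on
the order of its first two vertices: `P v u w = P u v w` (the edge forms and the circumsphere form
are alternating, and each defining inequality carries the orientation factor). [folklore] -/
theorem prism_swap (L : ℂ → ℂ → (Fin 3 → ℝ) → ℝ)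
    (hL : ∀ u v p, L u v p = (v.re - u.re) * (p 1 - u.im) - (v.im - u.im) * (p 0 - u.re))
    (S : ℂ → ℂ → ℂ → (Fin 3 → ℝ) → ℝ)
    (hS : ∀ u v w p, S u v w p = (p 0 ^ 2 + p 1 ^ 2 + p 2 ^ 2) * (u.re * (v.im - w.im) - u.im * (v.re - w.re) + (v.re * w.im - v.im * w.re)) - p 0 * (Complex.normSq u * (v.im - w.im) - u.im * (Complex.normSq v - Complex.normSq w) + (Complex.normSq v * w.im - v.im * Complex.normSq w)) + p 1 * (Complex.normSq u * (v.re - w.re) - u.re * (Complex.normSq v - Complex.normSq w) + (Complex.normSq v * w.re - v.re * Complex.normSq w)) - (Complex.normSq u * (v.re * w.im - v.im * w.re) - u.re * (Complex.normSq v * w.im - v.im * Complex.normSq w) + u.im * (Complex.normSq v * w.re - v.re * Complex.normSq w)))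
    (P : ℂ → ℂ → ℂ → Set (Fin 3 → ℝ))
    (hP : ∀ u v w, P u v w = {p | 0 < p 2 ∧ 0 < L u v ![w.re, w.im, 0] * L u v p ∧ 0 < L u v ![w.re, w.im, 0] * L v w p ∧ 0 < L u v ![w.re, w.im, 0] * L w u p ∧ 0 < L u v ![w.re, w.im, 0] * S u v w p})
    (u v w : ℂ) : P v u w = P u v w := by
  have hLa : ∀ x y p, L y x p = -L x y p := fun x y p => by rw [hL, hL]; ring
  have hSa : ∀ p, S v u w p = -S u v w p := fun p => by rw [hS, hS]; ring
  ext p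
  rw [hP, hP, Set.mem_setOf_eq, Set.mem_setOf_eq, hLa u v ![w.re, w.im, 0], hLa u v p, hLa w u p,
    hLa v w p, hSa p]
  simp only [neg_mul_neg]
  constructor
  · rintro ⟨h0, h1, h2, h3, h4⟩
    exact ⟨h0, h1, h3, h2, h4⟩
  · rintro ⟨h0, h1, h2, h3, h4⟩
    exact ⟨h0, h1, h3, h2, h4⟩

/-- **Reflection relation.** For a standard family `ρ` and algebraic `u`,
`B u + B (1 − u) ∈ KZ.relations` (`B = signedClass ρ`): by `stub_prismClass` with the similarity
`z ↦ z` (`a = 1, b = 0`), `B u ≡ sg u • [R']` for a `t⁻³`-representation `R'` on the prism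
`P 0 1 u`, and with the similarity `z ↦ 1 − z` (`a = −1, b = 1`), `B (1 − u) ≡ sg (1 − u) • [R]`
for a `t⁻³`-representation `R` on `P 1 0 u = P 0 1 u`; `[R'] − [R]` is a relation (same domain,
same integrand) and `sg (1 − u) = −sg u`. This is the two-term relation `D(1 − u) = −D(u)` of the
Bloch–Wigner function inside the calculus. [folklore] -/
theorem reflection_mem_relations (L : ℂ → ℂ → (Fin 3 → ℝ) → ℝ)
    (hL : ∀ u v p, L u v p = (v.re - u.re) * (p 1 - u.im) - (v.im - u.im) * (p 0 - u.re))
    (S : ℂ → ℂ → ℂ → (Fin 3 → ℝ) → ℝ)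
    (hS : ∀ u v w p, S u v w p = (p 0 ^ 2 + p 1 ^ 2 + p 2 ^ 2) * (u.re * (v.im - w.im) - u.im * (v.re - w.re) + (v.re * w.im - v.im * w.re)) - p 0 * (Complex.normSq u * (v.im - w.im) - u.im * (Complex.normSq v - Complex.normSq w) + (Complex.normSq v * w.im - v.im * Complex.normSq w)) + p 1 * (Complex.normSq u * (v.re - w.re) - u.re * (Complex.normSq v - Complex.normSq w) + (Complex.normSq v * w.re - v.re * Complex.normSq w)) - (Complex.normSq u * (v.re * w.im - v.im * w.re) - u.re * (Complex.normSq v * w.im - v.im * Complex.normSq w) + u.im * (Complex.normSq v * w.re - v.re * Complex.normSq w)))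
    (P : ℂ → ℂ → ℂ → Set (Fin 3 → ℝ))
    (hP : ∀ u v w, P u v w = {p | 0 < p 2 ∧ 0 < L u v ![w.re, w.im, 0] * L u v p ∧ 0 < L u v ![w.re, w.im, 0] * L v w p ∧ 0 < L u v ![w.re, w.im, 0] * L w u p ∧ 0 < L u v ![w.re, w.im, 0] * S u v w p})
    (sg : ℂ → ℤ) (hsg : ∀ w, sg w = if 0 < w.im then 1 else if w.im < 0 then -1 else 0)
    {ρ : ℂ → KZ.IntegralRep 3} (hρ : IsStandardOn ρ) {u : ℂ} (hu : IsAlgebraic ℚ u) :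
    signedClass ρ u + signedClass ρ (1 - u) ∈ KZ.relations := by
  have hB : ∀ z, signedClass ρ z = if 0 < z.im then KZ.of (ρ z) else if z.im < 0 then
      -KZ.of (ρ ((starRingEnd ℂ) z)) else 0 := fun _ => rfl
  have hρ' : ∀ z, IsAlgebraic ℚ z → 0 < z.im → (ρ z).domain = idealTetrahedron z ∧
      Set.EqOn (ρ z).integrand (fun p => 1 / p 2 ^ 3) (idealTetrahedron z) := hρ
  obtain ⟨R, hRd, hRi, hR⟩ := stub_prismClass L hL S hS P hP ρ hρ' (signedClass ρ) hB sg hsg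
    (-1) 1 (1 - u) 0 u isAlgebraic_one.neg isAlgebraic_one (isAlgebraic_one.sub hu)
    (neg_ne_zero.mpr one_ne_zero) (by ring) (by ring)
  obtain ⟨R', hR'd, hR'i, hR'⟩ := stub_prismClass L hL S hS P hP ρ hρ' (signedClass ρ) hB sg hsg
    1 0 u 1 u isAlgebraic_one isAlgebraic_zero hu one_ne_zero (by ring) (by ring)
  have hPP : P 1 0 u = P 0 1 u := prism_swap L hL S hS P hP 0 1 u
  have hRR : KZ.of R' - KZ.of R ∈ KZ.relations := by
    refine of_sub_of_mem_relations_of_eqOn (by rw [hRd, hR'd, hPP]) fun p hp => ?_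
    have hp' : p ∈ R.domain := by
      rw [hRd, hPP, ← hR'd]
      exact hp
    exact (hR'i hp).trans (hRi hp').symm
  have hsg' : sg (1 - u) = -sg u := by
    have him : (1 - u).im = -u.im := by simp
    rw [hsg, hsg u, him]
    rcases lt_trichotomy u.im 0 with h | h | h
    · have h1 : 0 < -u.im := neg_pos.mpr h
      simp [h, h1, not_lt.mpr h.le]
    · simp [h]
    · have h1 : -u.im < 0 := neg_neg_of_pos h
      simp [h, h1, not_lt.mpr h1.le]
  have e : signedClass ρ u + signedClass ρ (1 - u) =
      (signedClass ρ u - sg u • KZ.of R') + (signedClass ρ (1 - u) - sg (1 - u) • KZ.of R) +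
        sg u • (KZ.of R' - KZ.of R) := by
    rw [hsg', smul_sub, neg_smul]
    abel
  rw [e]
  exact add_mem (add_mem hR' hR) (AddSubgroup.zsmul_mem _ hRR _)

/-- **Duplication relation** for the signed class map `B = signedClass ρ` of a standard family:
for algebraic `w ∉ {0, 1, −1}`, `2 • B w − B (w²) + 2 • B (−w) ∈ KZ.relations`. It is the
`ℤ`-combination `F(w, w²) + refl(1/(1+w)) − 2·inv(1+w) + 2·refl(1+w)` of the five-term relation
`F(x, y) = B x − B y + B (y/x) − B ((1−x⁻¹)/(1−y⁻¹)) + B ((1−x)/(1−y))` (at `(w, w²)` its arguments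
are `w, w², w, w/(1+w), 1/(1+w)`), the reflection relations `B u + B (1 − u)` and the inversion
relation `B u + B u⁻¹`; in the Bloch group this is `{w²} = 2{w} + 2{−w}`.
[cite: DupontSah1982, Lemma 5.6] -/
theorem duplication_mem_relations {ρ : ℂ → KZ.IntegralRep 3} (hρ : IsStandardOn ρ) {w : ℂ}
    (hw : IsAlgebraic ℚ w) (hw0 : w ≠ 0) (hw1 : w ≠ 1) (hw1' : w ≠ -1) :
    2 • signedClass ρ w - signedClass ρ (w ^ 2) + 2 • signedClass ρ (-w) ∈ KZ.relations := by
  -- the pinned forms of the sibling crux `FiveTermTransfer`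
  let L : ℂ → ℂ → (Fin 3 → ℝ) → ℝ :=
    fun u v p => (v.re - u.re) * (p 1 - u.im) - (v.im - u.im) * (p 0 - u.re)
  let S : ℂ → ℂ → ℂ → (Fin 3 → ℝ) → ℝ := fun u v w p =>
    (p 0 ^ 2 + p 1 ^ 2 + p 2 ^ 2) * (u.re * (v.im - w.im) - u.im * (v.re - w.re) + (v.re * w.im - v.im * w.re)) - p 0 * (Complex.normSq u * (v.im - w.im) - u.im * (Complex.normSq v - Complex.normSq w) + (Complex.normSq v * w.im - v.im * Complex.normSq w)) + p 1 * (Complex.normSq u * (v.re - w.re) - u.re * (Complex.normSq v - Complex.normSq w) + (Complex.normSq v * w.re - v.re * Complex.normSq w)) - (Complex.normSq u * (v.re * w.im - v.im * w.re) - u.re * (Complex.normSq v * w.im - v.im * Complex.normSq w) + u.im * (Complex.normSq v * w.re - v.re * Complex.normSq w))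
  let P : ℂ → ℂ → ℂ → Set (Fin 3 → ℝ) := fun u v w =>
    {p | 0 < p 2 ∧ 0 < L u v ![w.re, w.im, 0] * L u v p ∧ 0 < L u v ![w.re, w.im, 0] * L v w p ∧ 0 < L u v ![w.re, w.im, 0] * L w u p ∧ 0 < L u v ![w.re, w.im, 0] * S u v w p}
  let sg : ℂ → ℤ := fun w => if 0 < w.im then 1 else if w.im < 0 then -1 else 0
  -- side conditions
  have h1w : 1 + w ≠ 0 := fun h => hw1' (by linear_combination h)
  have hw1'' : w - 1 ≠ 0 := sub_ne_zero.mpr hw1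
  have hw21 : w ^ 2 ≠ 1 := fun h => by
    rcases sq_eq_one_iff.mp h with h' | h'
    · exact hw1 h'
    · exact hw1' h'
  have hw21' : w ^ 2 - 1 ≠ 0 := sub_ne_zero.mpr hw21
  have hww : w ≠ w ^ 2 := fun h => by
    have h' : w * (w - 1) = 0 := by linear_combination -h
    rcases mul_eq_zero.mp h' with h'' | h''
    · exact hw0 h''
    · exact hw1'' h''
  -- the five-term relation at `(w, w²)`
  have h5 : fiveTerm (signedClass ρ) w (w ^ 2) ∈ KZ.relations :=
    (fiveTermTransfer_iff.mp FiveTermTransfer_of) ρ hρ w (w ^ 2) hw (hw.pow 2) hw0 hw1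
      (pow_ne_zero 2 hw0) hw21 hww
  have e3 : w ^ 2 / w = w := by field_simp
  have e4 : (1 - w⁻¹) / (1 - (w ^ 2)⁻¹) = w / (1 + w) := by
    rw [div_eq_div_iff (sub_ne_zero.mpr fun h => hw21 (inv_eq_one.mp h.symm)) h1w]
    field_simp
    ring
  have e5 : (1 - w) / (1 - w ^ 2) = 1 / (1 + w) := by
    rw [div_eq_div_iff (by intro h; exact hw21' (by linear_combination -h)) h1w]
    ring
  simp only [fiveTerm] at h5
  rw [e3, e4, e5] at h5
  -- the reflection relations at `1/(1+w)` and `1 + w`, the inversion relation at `1 + w`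
  have ha1 : IsAlgebraic ℚ (1 + w) := isAlgebraic_one.add hw
  have ha2 : IsAlgebraic ℚ (1 / (1 + w)) := by rw [one_div]; exact ha1.inv
  have hT1 := reflection_mem_relations L (fun _ _ _ => rfl) S (fun _ _ _ _ => rfl) P
    (fun _ _ _ => rfl) sg (fun _ => rfl) hρ ha2
  have e6 : 1 - 1 / (1 + w) = w / (1 + w) := by field_simp; ring
  rw [e6] at hT1
  have hT2 := reflection_mem_relations L (fun _ _ _ => rfl) S (fun _ _ _ _ => rfl) P
    (fun _ _ _ => rfl) sg (fun _ => rfl) hρ ha1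
  have e8 : 1 - (1 + w) = -w := by ring
  rw [e8] at hT2
  have hB : ∀ z, signedClass ρ z = if 0 < z.im then KZ.of (ρ z) else if z.im < 0 then
      -KZ.of (ρ ((starRingEnd ℂ) z)) else 0 := fun _ => rfl
  have hI := stub_inversionRelation ρ hρ (signedClass ρ) hB (1 + w) ha1
  rw [inv_eq_one_div] at hI
  -- bookkeeping in the free abelian group
  have e : 2 • signedClass ρ w - signedClass ρ (w ^ 2) + 2 • signedClass ρ (-w) =
      (signedClass ρ w - signedClass ρ (w ^ 2) + signedClass ρ w - signedClass ρ (w / (1 + w)) +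
        signedClass ρ (1 / (1 + w))) +
      (signedClass ρ (1 / (1 + w)) + signedClass ρ (w / (1 + w))) -
      2 • (signedClass ρ (1 + w) + signedClass ρ (1 / (1 + w))) +
      2 • (signedClass ρ (1 + w) + signedClass ρ (-w)) := by
    abel
  rw [e]
  exact add_mem (sub_mem (add_mem h5 hT1) (nsmul_mem hI 2)) (nsmul_mem hT2 2)

/-- **Tetrahedral halving** (stub `stub_tetraHalving` of skeleton v3): for a standard family `ρ`
and algebraic `z` with `Im z > 0` there are algebraic `w₁, w₂` in the upper half plane with
`[ρ z] − 2 • [ρ w₁] + 2 • [ρ w₂] ∈ KZ.relations`, namely `w₁ = w` the square root of `z` in the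
upper half plane and `w₂ = −w̄`: the duplication relation `2 B w − B (w²) + 2 B (−w)` of
`duplication_mem_relations`, read through `B w = [ρ w]`, `B (w²) = [ρ z]`, `B (−w) = −[ρ (−w̄)]`.
[cite: DupontSah1982, Lemma 5.6] -/
theorem stub_tetraHalving :
    ∀ (ρ : ℂ → KZ.IntegralRep 3),
      (∀ z, IsAlgebraic ℚ z → 0 < z.im →
        (ρ z).domain = idealTetrahedron z ∧ EqOn (ρ z).integrand (fun p => 1 / p 2 ^ 3) (idealTetrahedron z)) →
    ∀ z : ℂ, IsAlgebraic ℚ z → 0 < z.im →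
      ∃ w₁ w₂ : ℂ, IsAlgebraic ℚ w₁ ∧ IsAlgebraic ℚ w₂ ∧ 0 < w₁.im ∧ 0 < w₂.im ∧
        KZ.of (ρ z) - 2 • KZ.of (ρ w₁) + 2 • KZ.of (ρ w₂) ∈ KZ.relations := by
  intro ρ hρ z hz him
  have hρ' : IsStandardOn ρ := hρ
  -- a square root of `z` in the upper half plane
  obtain ⟨w, hw2, hwim⟩ : ∃ w : ℂ, w ^ 2 = z ∧ 0 < w.im := by
    obtain ⟨v, hv⟩ := IsAlgClosed.exists_pow_nat_eq z two_pos
    have hprod : 2 * v.re * v.im = z.im := by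
      rw [← hv, sq, Complex.mul_im]
      ring
    rcases lt_trichotomy v.im 0 with h | h | h
    · refine ⟨-v, by rw [neg_sq, hv], ?_⟩
      rw [Complex.neg_im]
      exact neg_pos.mpr h
    · exfalso
      rw [h, mul_zero] at hprod
      exact him.ne' hprod.symm
    · exact ⟨v, hv, h⟩
  have hw : IsAlgebraic ℚ w := IsAlgebraic.of_pow two_pos (by rw [hw2]; exact hz)
  have hw0 : w ≠ 0 := fun h => by simp [h] at hwim
  have hw1 : w ≠ 1 := fun h => by simp [h] at hwim
  have hw1' : w ≠ -1 := fun h => by simp [h] at hwim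
  have hnim : (-w).im < 0 := by simpa using hwim
  have key := duplication_mem_relations hρ' hw hw0 hw1 hw1'
  rw [hw2, signedClass_of_im_pos ρ hwim, signedClass_of_im_pos ρ him, signedClass_of_im_neg ρ hnim,
    map_neg] at key
  refine ⟨w, -conj w, hw, ?_, hwim, by simpa using hwim, ?_⟩
  · simpa using (hw.algHom (starRingEnd ℂ).toRatAlgHom).neg
  · have e : KZ.of (ρ z) - 2 • KZ.of (ρ w) + 2 • KZ.of (ρ (-conj w)) =
        -(2 • KZ.of (ρ w) - KZ.of (ρ z) + 2 • -KZ.of (ρ (-conj w))) := by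
      rw [smul_neg]
      abel
    rw [e]
    exact neg_mem key

end Summit.KontsevichZagierPeriods.HyperbolicBloch.OffTetraSectorKernel

end
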